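import Mathlib
import Summits.Ventures.PercRepro2.SepSplitTerm

/-!
# Gluing at a general separator, IX: the far count is again a typed count of a terminal kernel —
the identity iterates (blind cell PercRepro2, mine-2 g48, 2026-08-29; `conjectures/MINE-2.md` M2-98)

The far count of a data triple in `typedCount_eq_sepSplitT` reads the far-side data of the three
copies on their restriction to the far side.  On the support of a typed count over edges within the
far side, that restriction is the typed restriction to the restricted pinning
(`withinRestr_eq_restr_of_agree`), and a typed count of a kernel of `restr A z'` is the typed count
with the pinning `z'` (`typedCount_restr_z`, by the involution flipping the edges off `A` where the
two pinnings differ).  Hence `farCount_eq_typedCount_connData`: the far count is the typed count, on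
the far side with the pinning restricted to it, of a kernel of the connectivity of the terminals
`S ∪ (far terminals)` (`reshapeT`, `sideDataT_eq_reshapeT_connData`) — a kernel to which
`typedCount_eq_sepSplitT` applies again at any separator of the far side: the typed count
contracts along a tree decomposition of the support.  Own work; standard axioms.
-/

namespace Summit.Ventures.PercRepro2

open UnionCluster

namespace CovForm

namespace RootBridge

open OneTyped TypedA3 Untouched TypedFactor Separated

/-! ## Typed counts of kernels of the typed restriction -/

section RestrZ

variable {E : Type*} [Fintype E] [DecidableEq E] {R : Type*} [Field R]

/-- The involution of configurations flipping, off `A`, the edges where two pinnings differ. -/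
def flipOff (A : Finset E) (z z' : Config E) (x : Config E) : Config E :=
  fun e => if e ∈ A then x e else (x e != (z e != z' e))

omit [Fintype E] in
/-- Flipping twice is the identity. -/
lemma flipOff_flipOff (A : Finset E) (z z' x : Config E) :
    flipOff A z z' (flipOff A z z' x) = x := by
  funext e
  unfold flipOff
  by_cases he : e ∈ A
  · simp [he]
  · simp only [he, if_false]
    cases x e <;> cases z e <;> cases z' e <;> rfl

omit [Fintype E] in
/-- The flip agrees with `z` off `A` iff the configuration agrees with `z'` off `A`. -/
lemma flipOff_agree_iff {A : Finset E} {z z' x : Config E} :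
    (∀ e, e ∉ A → flipOff A z z' x e = z e) ↔ (∀ e, e ∉ A → x e = z' e) := by
  constructor <;> intro h e he <;> have := h e he <;> simp only [flipOff, he, if_false] at this ⊢ <;>
    revert this <;> cases x e <;> cases z e <;> cases z' e <;> simp

omit [Fintype E] in
/-- The flip does not change the edges of `A`. -/
lemma flipOff_of_mem {A : Finset E} (z z' x : Config E) {e : E} (he : e ∈ A) :
    flipOff A z z' x e = x e := by
  simp [flipOff, he]

omit [Fintype E] in
/-- On a configuration agreeing with `z'` off `A`, the typed restriction to `z'` of the flip is the
configuration itself. -/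
lemma restr_flipOff_eq_of_agree {A : Finset E} {z z' x : Config E}
    (hx : ∀ e, e ∉ A → x e = z' e) : restr A z' (flipOff A z z' x) = x := by
  funext e
  unfold restr
  by_cases he : e ∈ A
  · rw [if_pos he, flipOff_of_mem z z' x he]
  · rw [if_neg he, hx e he]

omit [Fintype E] in
/-- The flip preserves the open counts on `A`. -/
lemma openCount_flipOff {A : Finset E} (z z' x y w : Config E) {e : E} (he : e ∈ A) :
    openCount (flipOff A z z' x) (flipOff A z z' y) (flipOff A z z' w) e = openCount x y w e := by
  unfold openCount
  rw [flipOff_of_mem z z' x he, flipOff_of_mem z z' y he, flipOff_of_mem z z' w he]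

/-- **A typed count of a kernel of the typed restriction to `z'` is the typed count with the pinning
`z'`.** -/
theorem typedCount_restr_z (A : Finset E) (z z' : Config E) (τ : E → ℕ)
    (K : Config E → Config E → Config E → R) :
    typedCount A z τ (fun x y w => K (restr A z' x) (restr A z' y) (restr A z' w)) =
      typedCount A z' τ K := by
  unfold typedCount
  have hbij : Function.Bijective (flipOff A z z') :=
    Function.Involutive.bijective (flipOff_flipOff A z z')
  rw [← Fintype.sum_bijective (flipOff A z z') hbij _ _ (fun x => rfl)]
  refine Finset.sum_congr rfl fun x _ => ?_
  rw [← Fintype.sum_bijective (flipOff A z z') hbij _ _ (fun y => rfl)]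
  refine Finset.sum_congr rfl fun y _ => ?_
  rw [← Fintype.sum_bijective (flipOff A z z') hbij _ _ (fun w => rfl)]
  refine Finset.sum_congr rfl fun w _ => ?_
  have hcond : ((∀ e, e ∉ A → flipOff A z z' x e = z e ∧ flipOff A z z' y e = z e ∧
        flipOff A z z' w e = z e) ∧
      (∀ e ∈ A, openCount (flipOff A z z' x) (flipOff A z z' y) (flipOff A z z' w) e = τ e)) ↔
      ((∀ e, e ∉ A → x e = z' e ∧ y e = z' e ∧ w e = z' e) ∧
        (∀ e ∈ A, openCount x y w e = τ e)) := by
    constructor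
    · rintro ⟨h1, h2⟩
      refine ⟨fun e he => ⟨flipOff_agree_iff.mp (fun e he => (h1 e he).1) e he,
        flipOff_agree_iff.mp (fun e he => (h1 e he).2.1) e he,
        flipOff_agree_iff.mp (fun e he => (h1 e he).2.2) e he⟩, fun e he => ?_⟩
      rw [← openCount_flipOff z z' x y w he]
      exact h2 e he
    · rintro ⟨h1, h2⟩
      refine ⟨fun e he => ⟨flipOff_agree_iff.mpr (fun e he => (h1 e he).1) e he,
        flipOff_agree_iff.mpr (fun e he => (h1 e he).2.1) e he,
        flipOff_agree_iff.mpr (fun e he => (h1 e he).2.2) e he⟩, fun e he => ?_⟩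
      rw [openCount_flipOff z z' x y w he]
      exact h2 e he
  by_cases hc : (∀ e, e ∉ A → x e = z' e ∧ y e = z' e ∧ w e = z' e) ∧
      (∀ e ∈ A, openCount x y w e = τ e)
  · rw [if_pos (hcond.mpr hc), if_pos hc]
    show K (restr A z' (flipOff A z z' x)) (restr A z' (flipOff A z z' y))
      (restr A z' (flipOff A z z' w)) = K x y w
    rw [restr_flipOff_eq_of_agree (fun e he => (hc.1 e he).1),
      restr_flipOff_eq_of_agree (fun e he => (hc.1 e he).2.1),
      restr_flipOff_eq_of_agree (fun e he => (hc.1 e he).2.2)]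
  · rw [if_neg (fun h => hc (hcond.mp h)), if_neg hc]

end RestrZ

/-! ## The side restriction on the support is a typed restriction -/

section SideRestr

variable {V : Type*} {E : Type*} [DecidableEq E] (ends : E → Sym2 V)

/-- On configurations agreeing with `z` off a set `A` of edges within `W`, the restriction to `W`
is the typed restriction to the restricted pinning. -/
lemma withinRestr_eq_restr_of_agree (W : Set V) {A : Finset E}
    (hA : ∀ e ∈ A, e ∈ within ends W) {z x : Config E} (hx : ∀ e, e ∉ A → x e = z e) :
    withinRestr ends W x = restr A (withinRestr ends W z) x := by
  funext e
  unfold withinRestr restr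
  by_cases he : e ∈ A
  · simp [he, hA e he]
  · simp only [he, if_false]
    rw [hx e he]

end SideRestr

/-! ## The far count is a typed count of a terminal kernel on the far side -/

section Iterate

open Classical

variable {V : Type*} {E : Type*} {ι ζ : Type*} [Fintype E] [DecidableEq E] {R : Type*} [Field R]
variable (ends : E → Sym2 V) (Z : ζ → V) (σ : ι → V)

/-- The side data read off the connectivity of the terminals `ζ ⊕ ι` (terminals first, then the
separator vertices). -/
def reshapeT (c : ζ ⊕ ι → ζ ⊕ ι → Bool) : SideDataT ι ζ :=
  (fun k l => c (Sum.inl k) (Sum.inl l), fun i k => c (Sum.inr i) (Sum.inl k),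
    fun i j => c (Sum.inr i) (Sum.inr j))

omit [Fintype E] [DecidableEq E] in
/-- The side data of a configuration are the reshaped connectivity of `S ∪ Z`. -/
lemma sideDataT_eq_reshapeT_connData (y : Config E) :
    sideDataT ends Z σ y = reshapeT (connData ends (Sum.elim Z σ) y) := by
  unfold sideDataT reshapeT connData
  rfl

/-- The kernel of the terminal connectivity of `S ∪ Z` that the far count evaluates: the exact
indicators of a data triple. -/
noncomputable def exactKT (p : Pat3T ι ζ) (c₁ c₂ c₃ : ζ ⊕ ι → ζ ⊕ ι → Bool) : ℤ :=
  exactT p.1 (reshapeT c₁) * exactT p.2.1 (reshapeT c₂) * exactT p.2.2 (reshapeT c₃)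

/-- **The far count is a typed count of a terminal kernel on the far side**: over edges within
`VL`, the count of the far kernel with the pinning `z` is the count of the exact-indicator kernel
of the connectivity of `S ∪ Z`, with the pinning restricted to `VL`. -/
theorem farCount_eq_typedCount_connData (VL : Set V) {A : Finset E}
    (hA : ∀ e ∈ A, e ∈ within ends VL) (z : Config E) (τ : E → ℕ) (p : Pat3T ι ζ) :
    typedCount A z τ (farKT ends Z σ VL p : Config E → Config E → Config E → R) =
      typedCount A (withinRestr ends VL z) τ (fun x y w =>
        ((exactKT p (connData ends (Sum.elim Z σ) x) (connData ends (Sum.elim Z σ) y)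
          (connData ends (Sum.elim Z σ) w) : ℤ) : R)) := by
  rw [← typedCount_restr_z A z (withinRestr ends VL z) τ]
  refine typedCount_congr_on_support A z τ fun x y w hc _ => ?_
  unfold farKT exactKT
  rw [withinRestr_eq_restr_of_agree ends VL hA (fun e he => (hc e he).1),
    withinRestr_eq_restr_of_agree ends VL hA (fun e he => (hc e he).2.1),
    withinRestr_eq_restr_of_agree ends VL hA (fun e he => (hc e he).2.2)]
  simp only [sideDataT_eq_reshapeT_connData]

/-- The far count in the identity `typedCount_eq_sepSplitT` is such a count (`A = sideF ends VL F`). -/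
theorem farCount_sideF_eq_typedCount_connData (VL : Set V) (F : Finset E) (z : Config E)
    (τ : E → ℕ) (p : Pat3T ι ζ) :
    typedCount (sideF ends VL F) z τ (farKT ends Z σ VL p : Config E → Config E → Config E → R) =
      typedCount (sideF ends VL F) (withinRestr ends VL z) τ (fun x y w =>
        ((exactKT p (connData ends (Sum.elim Z σ) x) (connData ends (Sum.elim Z σ) y)
          (connData ends (Sum.elim Z σ) w) : ℤ) : R)) :=
  farCount_eq_typedCount_connData ends Z σ VL
    (fun _ he => (Finset.mem_filter.mp he).2) z τ p

end Iterate

end RootBridge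

end CovForm

end Summit.Ventures.PercRepro2
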